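import Summits.CriticalPhenomena.PercolationContinuityZ3.Theorems.Transplant.FKConnectivityAllQApexHubRest
import Summits.CriticalPhenomena.PercolationContinuityZ3.Theorems.Transplant.FKConnectivityAllQSPAllPairs
import HarnessLib

/-!
# Connectivity correlation inequalities for `φ_{w,q}` — the hub inequality at an APEX HUNG ON A SERIES–PARALLEL GRAPH: unconditional
# instances of the gen-23 reduction theorems, EVERY `q > 0`

Support file (`--supports stmt-CriticalPhenomena-4575`), census seat `prim-bschramm-census` (gen 23) of the post-continuity programme;
builds on p205010 (kernel theorem, internal audit signed; external expert review pending).  No definitions, no named facts, no sorries;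
standard axioms.  Corollaries of `…ApexHubRest.lean` (`hubUnder_apex_rest_o/_a/_b`: on the triple `{x, u, t}` an apex `x` over `(u, v)` may be
traded for the opposite hub `v`) and fk-2 g7's `hubUnder_of_isTTSP_mem` (ALR's (13) at two EDGES of a completed two-terminal series–parallel support).

SETTING.  `E` a two-terminal series–parallel network between `s₀, t₀`, `S = E ∪ {s₀t₀}` its completed support; `x` a vertex OFF `S` hung on two
vertices `u ≠ v` by the pairs `ux, xv`; `w` supported in `S ∪ {ux, xv}`; `t ≠ x`.  THEOREMS (every `q > 0`):
* **`hubUnder_apexSP_b`**: if `ut, vt ∈ S` then `φ(x ↔ t)·φ(u ↔ t) ≤ φ(x ↔ t ↔ u)` — hub `t`, and the hub pair `xt` is NOT a pair of the support;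
* **`hubUnder_apexSP_o`**: if `vu, tu ∈ S` then `φ(x ↔ u)·φ(t ↔ u) ≤ φ(x ↔ u ↔ t)`;
* **`hubUnder_apexSP_a`**: if `uv, tv ∈ S` then `φ(u ↔ x)·φ(t ↔ x) ≤ φ(u ↔ x ↔ t)` — hub at the apex, hub pair `tx` not a support pair.
These are instances of ALR's printed open inequality (13) for `q < 1` not covered by `hubUnder_of_isTTSP_mem` (which needs BOTH hub pairs to be edges of
the completed support): here one hub pair is the non-pair `xt`, and `S ∪ {ux, xv}` itself need not be series–parallel (`uv` need not complete to an SP network).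
[cite: AyyerLinussonRavichandran2025, §7 eq. (13)–(15), Conj. 7.1 (p. 22)] [cite: Wagner2006, §5.3] [cite: Grimmett2006, §3.9 (p. 63); Thm. (3.8)]
-/

noncomputable section

namespace Summit.CriticalPhenomena.PercolationContinuityZ3.Theorems

namespace FK

open MeasureTheory Set Literature.Probability.LatticeModels Literature.Probability.Percolation
open scoped Classical

variable {V : Type*} [Fintype V] {q : ℝ} {E : Finset (Sym2 V)} {s₀ t₀ : V}

omit [Fintype V] in
/-- The apex hypothesis from a support hypothesis: if `supp(w) ⊆ S ∪ {ux, xv}` and `x` is off `S`, every live pair at `x` is `ux` or `xv`. [folklore] -/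
theorem apex_of_supp_insert (w : Sym2 V → unitInterval) {u v x : V} (S : Finset (Sym2 V)) (hx : ∀ e ∈ S, x ∉ e)
    (hw : ∀ e, ((w e : unitInterval) : ℝ) ≠ 0 → e ∈ S ∨ e = s(u, x) ∨ e = s(x, v)) :
    ∀ e : Sym2 V, x ∈ e → ((w e : unitInterval) : ℝ) ≠ 0 → u ∈ e ∨ v ∈ e := by
  intro e hxe hne
  rcases hw e hne with h | rfl | rfl
  · exact absurd hxe (hx e h)
  · exact Or.inl (Sym2.mem_mk_left u x)
  · exact Or.inr (Sym2.mem_mk_right x v)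

omit [Fintype V] in
/-- Deleting the apex pairs leaves a vector supported in `S`. [folklore] -/
theorem supp_apexDeleted (w : Sym2 V → unitInterval) {u v x : V} (S : Finset (Sym2 V))
    (hw : ∀ e, ((w e : unitInterval) : ℝ) ≠ 0 → e ∈ S ∨ e = s(u, x) ∨ e = s(x, v)) :
    ∀ e, ((Function.update (Function.update w s(u, x) 0) s(x, v) 0 e : unitInterval) : ℝ) ≠ 0 → e ∈ (↑S : Set (Sym2 V)) := by
  intro e hne
  by_cases hb : e = s(x, v)
  · subst hb; simp at hne
  by_cases ha : e = s(u, x)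
  · subst ha; rw [Function.update_of_ne hb] at hne; simp at hne
  rw [Function.update_of_ne hb, Function.update_of_ne ha] at hne
  rcases hw e hne with h | h | h
  · exact h
  · exact absurd h ha
  · exact absurd h hb

/-- **Hub inequality at `(x; t; u)` for an apex `x` over `(u, v)` hung on a completed series–parallel support containing the pairs `ut, vt`**,
every `q > 0`: `φ_{w,q}(x ↔ t)·φ_{w,q}(u ↔ t) ≤ φ_{w,q}(x ↔ t ↔ u)` (the hub pair `xt` is not a pair of the support).
[cite: AyyerLinussonRavichandran2025, §7 eq. (13) (p. 22)] [cite: Wagner2006, §5.3] -/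
theorem hubUnder_apexSP_b (w : Sym2 V → unitInterval) (hq : 0 < q) (hE : IsTTSP E s₀ t₀) {u v x t : V} (hxu : x ≠ u) (hxv : x ≠ v)
    (huv : u ≠ v) (htx : t ≠ x) (hx : ∀ e ∈ insert s(s₀, t₀) E, x ∉ e)
    (hw : ∀ e, ((w e : unitInterval) : ℝ) ≠ 0 → e ∈ insert s(s₀, t₀) E ∨ e = s(u, x) ∨ e = s(x, v))
    (hut : s(u, t) ∈ insert s(s₀, t₀) E) (hvt : s(v, t) ∈ insert s(s₀, t₀) E) :
    HubUnder (rcMeasureW w q ∅) x t u :=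
  hubUnder_apex_rest_b w hq hxu hxv huv htx (apex_of_supp_insert w _ hx hw)
    (hubUnder_of_isTTSP_mem hq hE hut hvt _ (supp_apexDeleted w _ hw))

/-- **Hub inequality at `(x; u; t)` for an apex `x` over `(u, v)` hung on a completed series–parallel support containing the pairs `vu, tu`**,
every `q > 0`: `φ_{w,q}(x ↔ u)·φ_{w,q}(t ↔ u) ≤ φ_{w,q}(x ↔ u ↔ t)`. [cite: AyyerLinussonRavichandran2025, §7 eq. (13) (p. 22)] [cite: Wagner2006, §5.3] -/
theorem hubUnder_apexSP_o (w : Sym2 V → unitInterval) (hq : 0 < q) (hE : IsTTSP E s₀ t₀) {u v x t : V} (hxu : x ≠ u) (hxv : x ≠ v)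
    (huv : u ≠ v) (htx : t ≠ x) (hx : ∀ e ∈ insert s(s₀, t₀) E, x ∉ e)
    (hw : ∀ e, ((w e : unitInterval) : ℝ) ≠ 0 → e ∈ insert s(s₀, t₀) E ∨ e = s(u, x) ∨ e = s(x, v))
    (hvu : s(v, u) ∈ insert s(s₀, t₀) E) (htu : s(t, u) ∈ insert s(s₀, t₀) E) :
    HubUnder (rcMeasureW w q ∅) x u t :=
  hubUnder_apex_rest_o w hq hxu hxv huv htx (apex_of_supp_insert w _ hx hw)
    (hubUnder_of_isTTSP_mem hq hE hvu htu _ (supp_apexDeleted w _ hw))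

/-- **Hub inequality at `(u; x; t)` (hub AT the apex) for an apex `x` over `(u, v)` hung on a completed series–parallel support containing the pairs
`uv, tv`**, every `q > 0`: `φ_{w,q}(u ↔ x)·φ_{w,q}(t ↔ x) ≤ φ_{w,q}(u ↔ x ↔ t)` (the hub pair `tx` is not a pair of the support).
[cite: AyyerLinussonRavichandran2025, §7 eq. (13) (p. 22)] [cite: Wagner2006, §5.3] -/
theorem hubUnder_apexSP_a (w : Sym2 V → unitInterval) (hq : 0 < q) (hE : IsTTSP E s₀ t₀) {u v x t : V} (hxu : x ≠ u) (hxv : x ≠ v)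
    (huv : u ≠ v) (htx : t ≠ x) (hx : ∀ e ∈ insert s(s₀, t₀) E, x ∉ e)
    (hw : ∀ e, ((w e : unitInterval) : ℝ) ≠ 0 → e ∈ insert s(s₀, t₀) E ∨ e = s(u, x) ∨ e = s(x, v))
    (huv' : s(u, v) ∈ insert s(s₀, t₀) E) (htv : s(t, v) ∈ insert s(s₀, t₀) E) :
    HubUnder (rcMeasureW w q ∅) u x t :=
  hubUnder_apex_rest_a w hq hxu hxv huv htx (apex_of_supp_insert w _ hx hw)
    (hubUnder_of_isTTSP_mem hq hE huv' htv _ (supp_apexDeleted w _ hw))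

end FK

end Summit.CriticalPhenomena.PercolationContinuityZ3.Theorems

end
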